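import Literature.NumberTheory.EllipticCurves.CuspFormLFunctionLevelConductorCarayolProofs
import Literature.NumberTheory.EllipticCurves.NewformGaloisRepArtinConductor
import HarnessLib

/-!
# Level `=` conductor for the newform of an elliptic curve over `ℚ`, from the NAMED Carayol fact
# (proofs only)

Proof file (theorems only: no definition, no named fact, no instance); the by-name form of
`CuspFormLFunctionLevelConductorCarayolProofs`, whose theorems carry Carayol's conductor theorem as
the explicit hypothesis `hC`.  That hypothesis is now the named fact
`Carayol1986_artinConductorExponent` (`NewformGaloisRepArtinConductor`: the Artin conductor
exponent at `q ≠ p` of every irreducible `p`-adic representation attached to a newform of weight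
`k ≥ 2` and level `N` is `v_q(N)` — Carayol 1986, Thm. (A); Darmon–Diamond–Taylor 1995,
Thm. 3.1 (d)), so the tree's named fact `IsNewformOf.level_eq_conductorNorm`
(`CuspFormLFunction`: the level of the newform of an elliptic `W / ℚ` is its conductor `N_W`;
Carayol 1986, (0.8) Corollaire; Diamond–Shurman Thm. 8.8.1) reads, by name:

* `IsNewformOf.level_eq_conductorNorm_of_carayol1986_of_forall_not_hasAdditiveReductionAt_two` —
  for a curve not additive at `2`, modulo `Carayol1986_artinConductorExponent` ALONE;
* `IsNewformOf.level_eq_conductorNorm_of_carayol1986_of_saito` — for every elliptic curve, modulo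
  `Carayol1986_artinConductorExponent` and Saito's `p = 2` half of Ogg's formula for that curve
  (`WeierstrassCurve.swanConductorAt_rationalTate_eq_wildConductorExponent_of_ringChar_eq_two`,
  Saito 1988; the one leaf of the tree's Ogg–Saito comparison not yet discharged);
* `IsNewformOf.forall_level_eq_conductorNorm_of_carayol1986_of_saito` — the `∀ N` closure
  `∀ (N : ℕ) [NeZero N], IsNewformOf.level_eq_conductorNorm (N := N)` (verbatim the signature of the
  BSD ledger item "NewformLevelEqConductor"), modulo the two named facts;
* `IsNewformOf.padicValNat_level_eq_of_carayol1986_of_ne_two` — `v_q(N) = v_q(N_W)` at every odd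
  prime, modulo `Carayol1986_artinConductorExponent` alone.

Nothing is claimed in the converse direction; no modularity theorem is used; no summit statement
is touched.

## References

* H. Carayol, Ann. Sci. ÉNS (4) 19 (1986) 409–468, Thm. (A), (0.8) Corollaire (pp. 410–411).
  [CarayolASENS1986]
* H. Darmon, F. Diamond, R. Taylor, *Fermat's Last Theorem*, CDM 1995, §2.1 (p. 54), Thm. 3.1 (d)
  (pp. 86–87). [DarmonDiamondTaylor1995]
* F. Diamond, J. Shurman, *A First Course in Modular Forms*, GTM 228 (2005), Thm. 8.8.1.
  [DiamondShurman2005]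
* T. Saito, Duke Math. J. 57 (1988), Thm. 1. [Saito1988]
-/

noncomputable section

open scoped NumberField MatrixGroups ModularForm
open NumberField IsDedekindDomain CongruenceSubgroup
  Literature.NumberTheory.GaloisRepresentations Literature.NumberTheory.EllipticCurves

namespace Literature.NumberTheory.EllipticCurves.ModularForms

variable {N : ℕ} [NeZero N] {W : WeierstrassCurve ℚ} [W.IsElliptic] {f : CuspForm (Gamma0 N) 2}

/-- **Level `=` conductor for an elliptic curve not additive at `2`, modulo the named fact
`Carayol1986_artinConductorExponent` alone.**  For an elliptic `W / ℚ` with no additive place of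
residue characteristic `2`, and its newform `f ∈ S₂(Γ₀(N))` at any level (`IsNewformOf W f`):
`N = N_W` (`IsNewformOf.level_eq_conductorNorm_of_carayol_of_forall_not_hasAdditiveReductionAt_two`
fed with the named fact). [cite: CarayolASENS1986, Thm. (A), (0.8) Corollaire (pp. 410–411)]
[cite: DarmonDiamondTaylor1995, Thm. 3.1 (d) with §2.1 (p. 54)] [cite: DiamondShurman2005, Thm. 8.8.1] -/
theorem IsNewformOf.level_eq_conductorNorm_of_carayol1986_of_forall_not_hasAdditiveReductionAt_two
    (hC : Carayol1986_artinConductorExponent) (hf : IsNewformOf W f)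
    (h2 : ∀ w : HeightOneSpectrum (𝓞 ℚ), ringChar (𝓞 ℚ ⧸ w.asIdeal) = 2 →
      ¬ W.HasAdditiveReductionAt w) :
    N = W.conductorNorm ℤ :=
  hf.level_eq_conductorNorm_of_carayol_of_forall_not_hasAdditiveReductionAt_two hC h2

/-- **Level `=` conductor for every elliptic curve over `ℚ`, modulo the named facts
`Carayol1986_artinConductorExponent` and (Saito 1988, `p = 2`)
`W.swanConductorAt_rationalTate_eq_wildConductorExponent_of_ringChar_eq_two ℓ` for the curve at
hand.**  For an elliptic `W / ℚ` and its newform `f ∈ S₂(Γ₀(N))` at any level: `N = N_W`.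
[cite: CarayolASENS1986, Thm. (A), (0.8) Corollaire (pp. 410–411)]
[cite: DarmonDiamondTaylor1995, Thm. 3.1 (d) with §2.1 (p. 54)] [cite: Saito1988, Theorem 1]
[cite: DiamondShurman2005, Thm. 8.8.1] -/
theorem IsNewformOf.level_eq_conductorNorm_of_carayol1986_of_saito
    (hC : Carayol1986_artinConductorExponent)
    (hS : ∀ (ℓ : ℕ) [Fact ℓ.Prime],
      W.swanConductorAt_rationalTate_eq_wildConductorExponent_of_ringChar_eq_two ℓ)
    (hf : IsNewformOf W f) : N = W.conductorNorm ℤ :=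
  hf.level_eq_conductorNorm_of_carayol_of_saito hC hS

/-- **`v_q(N) = v_q(N_W)` at every odd prime `q`, modulo `Carayol1986_artinConductorExponent`
alone** (no input at the place `2` is needed away from `2`).
[cite: CarayolASENS1986, Thm. (A), (0.8) Corollaire (pp. 410–411)]
[cite: DarmonDiamondTaylor1995, Thm. 3.1 (d) with §2.1 (p. 54)] -/
theorem IsNewformOf.padicValNat_level_eq_of_carayol1986_of_ne_two
    (hC : Carayol1986_artinConductorExponent) (hf : IsNewformOf W f) {q : ℕ} (hq : q.Prime)
    (hq2 : q ≠ 2) : padicValNat q N = padicValNat q (W.conductorNorm ℤ) :=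
  hf.padicValNat_level_eq_of_carayol_of_ne_two hC hq hq2

omit [NeZero N] [W.IsElliptic] in
/-- **The tree's named fact `IsNewformOf.level_eq_conductorNorm` at every level — the `∀ N`
closure `∀ (N : ℕ) [NeZero N], IsNewformOf.level_eq_conductorNorm (N := N)` — from the two named
facts `Carayol1986_artinConductorExponent` (Carayol 1986 Thm. (A) / Darmon–Diamond–Taylor
Thm. 3.1 (d)) and Saito's `p = 2` theorem for all curves.**  Independent of the modularity theorem;
nothing is claimed in the converse direction. [cite: CarayolASENS1986, Thm. (A), (0.8) Corollaire (pp. 410–411)]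
[cite: DarmonDiamondTaylor1995, Thm. 3.1 (d) with §2.1 (p. 54)] [cite: Saito1988, Theorem 1]
[cite: DiamondShurman2005, Thm. 8.8.1] -/
theorem IsNewformOf.forall_level_eq_conductorNorm_of_carayol1986_of_saito
    (hC : Carayol1986_artinConductorExponent)
    (hS : ∀ (V : WeierstrassCurve ℚ) (ℓ : ℕ) [Fact ℓ.Prime],
      V.swanConductorAt_rationalTate_eq_wildConductorExponent_of_ringChar_eq_two ℓ) :
    ∀ (N : ℕ) [NeZero N], IsNewformOf.level_eq_conductorNorm (N := N) :=
  fun _ _ ↦ IsNewformOf.level_eq_conductorNorm_of_carayol_of_saito' hC hS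

end Literature.NumberTheory.EllipticCurves.ModularForms

end
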